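import Summits.QuantumFields.BalabanUV.T4Continuum.Support.NE9CurChartTowerPiLipschitzAtFlatLatticeUniform
import Literature.MathematicalPhysics.QuantumFieldTheory.Balaban1983to89.B11Eq44COperatorTowerTwoBackgrounds

/-!
# NE9CurChartTowerPiLipschitzAtFlatLatticeUniformC — THE CHART OF THE CURVE SPECIES `cur U` FOR PRINT's `k`-TH-STEP OPERATOR (3.122) IS LIPSCHITZ IN THE
# BACKGROUND AT THE FLAT POINT WITH ONE CONSTANT FOR EVERY HEIGHT `k = n+1`, EVERY SPACING ON THE DIAGONAL, EVERY PERIOD `m`: for every background `U` of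
# the cell's MODEL block, every pair of admissible (L3) slots with a background modulus `δ_W` on one ball, and every `B ∈ ball 0 R_b`:
# `‖ι(chart_U B) − chart_1 B‖_(115),∇_1 ≤ K·((j₀ + α) + δ_W)` with `α₁ j₁ ε₄ ε_C R_b r K` BEFORE `∀ n η m U` — the sibling `NE9CurChartTowerPiLipschitzAtFlatLatticeUniform`
# (this seat, gen 104) WITH ITS DISPLAYED `C_k`-MODULUS `δ_C` DISCHARGED by `B11Eq44COperatorTowerTwoBackgrounds.sectC_modulus_tower` ([B7] Prop. 7 at `k` levels read as a
# background modulus: `δ_C = (24∕r′)·α·(ε_C + a_C)`, `r′` = Prop. 7's polydisc radius in coarse units — the five smallness inequalities of Prop. 7's regime DISPLAYED as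
# numerics on `(α₀, r′, r)`); cell `pub-balaban`, T4-DAG §2 node U3 ∕ §6 NE9, WALL-NE9-P1 §3 (ii); NE9 crux-team (2) LEAF PROVER 01 (`b2b-balaban-t4-ne9-formalise-leaf-01`,
# gen 104); Summits-side NEW leaf under this seat's INTERFACE REQUEST NE9 [NE9LEAF01-G104-IFR-2] (HOME/INBOX.md; ruling e34b3e0c (0)); nothing printed asserted

HONEST FRAMING (T4-DAG PAGE 1).  Rung (B)+1 of the FINITE-VOLUME T⁴ programme — NOT infinite volume, NOT a mass gap, NOT the Clay problem.  NE9 is a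
cell NEW ESTIMATE, NOT PRINTED in [Balaban1987RG1] ∕ [Balaban1988RG2Cluster], and NOT PROVED here («NE9 ⇐ the named binders»; spine PROVED 0∕9).  HONEST
DEPENDENCY (cell line, verbatim): continuum YM on T⁴ ⇐ BetaPertH ∧ nine spine estimates (0/9 proved); BetaPertH ⇐ (D1) ∧ (D4) ∧ CAP+tail; G-an2-4
gates asym, D1 and NE2/3/4.  The `cur U` OBJECT is ONE item of the MODEL O-NE9-1 (species (a) data); `act` ∕ `ker` and NEEDS-COORDINATOR #5 untouched.

WHAT THIS FILE PROVES (ONE theorem; 0 def, 0 sorry, axioms standard).  **`cur_chart_tower_pi_lipschitz_at_flat_lattice_uniform_C`** —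
for fixed `L`, the fibre ∕ trace letters, print's `a, a′ > 0`, the level-profile room `(ϱ, AQ, ρ_w)`, `C_k`'s numerics (`G ≤ U1` averaging-closed, `α₀`, `ρ`), the (L3)
constants `(C₄, a₃)`, two numbers `ω, Ω ≥ 0` bounding the (115) weight profile, and the realification basis `b` of `𝔸`: `∃ α₁ j₁ ε₄ ε_C R_b r K` (all `> 0`) BEFORE
`∀`, such that for EVERY height `n`, spacing `η` on the diagonal, period `m`, background `U` with the MODEL block's data VERBATIM (the binder block of this lineage's
`B11Eq174ChartLipschitzAtFlatLatticeFreeClosed.exists_chartHB_lipschitz_at_flat_latticeFree`: per-level profile, windows, unitarity, ANY positivity ∕ onto witnesses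
`hpos′ hpos hposπ hQ` at `U` and `hpos′₁ hpos₁ hQ1` at the vacuum), `Ũ ∈ G`, level maps with `n+1 ≤ lev₀` and weight profile `w̄₀, w̄₁ ≤ ω`, `w̲₁⁻¹, w̲₃⁻¹, w̲_B⁻¹ ≤ Ω`,
every pair of (L3) slots `W₁` (over `∇_U`), `W₂` (over `∇_1`) with `QuadAnalytic · C₄ a₃`, every DISPLAYED modulus `δ_W ≥ 0` with `‖W₁P − W₂(ιP)‖ ≤ δ_W` on `‖P‖ < r`,
and every `B` with `‖B‖ < R_b`:
`‖ι(chartHB 𝔊̃_k(U) 0 W₁ 0 (A′ ↦ A′ + solA H̃_{1,k}(U) 0 C_k(U) 0 ε_C A′) ε₄ H̃_{1,k}(U) B) − chartHB 𝔊_k(1) 0 W₂ 0 (…) ε₄ H_{1,k}(1) B‖ ≤ K·((j₀ + α) + δ_W)`.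
PROOF = (Z)'s outer assembly at the tower with LATTICE-FREE suppliers: `exists_chartHB_lipschitz_at_flat_latticeFree` (the chart-level composition with the letter
defects `δ̃_A`, `δ̃_G`, `K_ι` PRODUCED free of the lattice — ROUTE (J′): this lineage's gens 99–104, the located letter `Hω` discharged in gen 104); the two operator norms
`exists_norm_chartLetters_le` at `U` and at the vacuum (the vacuum is in the class with `α = 0`, `j₀ = 0`: `NE9CurChartTowerPiLatticeUniformFlatWitness.flat_mem_class`; print's
letters at the vacuum ARE the chain's: `B9Eq3119DeltaPiTowerFlat.letters_laplaceAkPi_one`, §1); the scalar letters WITH ROOM `B11Eq118RegimeScalars.exists_twoRegimes_radii_of_bounds_room_cap`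
at `(B₀, b, b₁) := ω·M_φBM_φ′·Ω`, `(C₂, c₄) := (C2T d α₀, ρ)`; `C_k`'s `QuadAnalytic` at `U` and at `1` (`B11Eq44CLetterTower.quadAnalytic_Cck`, (52) from the plaquette
window); the radius bookkeeping `ρ := 2(ε₄ + a)`, `s := ε₄ + a` under `K_ι = 1 + w̄₁·2α·w̲₁⁻¹ ≤ 2` (`α ≤ 1∕(2ωΩ + 1)`); `δ_C` from `sectC_modulus_tower` at
`ρ′ := r′∕L^{n+1}`, `ρ := r∕L^{n+1}`, `ε := αη` (`L^{n+1}αη = α`), the Sect. C ball capped at `r∕2` (`6α ≤ r′`).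
DISGUISE TEST: composition by name of landed theorems; no inequality of the series proved HERE; constants crude and symbolic (NOT print's `B₀`); `j₀` and `α`
displayed separately; the per-level profile, the positivity ∕ surjectivity witnesses, the weight-profile bounds, the (L3) slots WITH their modulus `δ_W` and Prop. 7's
numerics stay DISPLAYED (δ_W's lattice-free discharge = the successor's bricks: the (3.122) current letter, the V₀-group, the junction `B11Eq98W80ModulusLetterDefects`);
NOT the gauge step of p. 416, NOT claimed that Bałaban's 𝐇_k ∕ U_j(□₀, exp iB) meet these letters (O-NE9-1; #5 UNRULED); not NE9.  What IS new relative to (Z): NO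
constant depends on the height, the spacing or the period.
References (TYPES ∕ loci only): [Balaban1985Variational] (44)–(47) p. 285, (103) p. 293, Prop. 6 (117)–(121) p. 295, (172)–(175) p. 305, Prop. 9 p. 309;
[Balaban1985BackgroundPropagators] (3.35)–(3.37) p. 396, Thm 3.1 (3.42)∕(3.47) pp. 397–398, Thm 3.4 p. 400, (3.122)–(3.126) p. 420, (3.152)–(3.153) p. 426, Thm 3.13 p. 426;
[Balaban1985Averaging] Prop. 2 (52)–(54) p. 26.
-/

noncomputable section

open Metric Set

namespace Summit.QuantumFields.BalabanUV.T4Continuum.NE9CurChartTowerPiLipschitzAtFlatLatticeUniformC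

open scoped InnerProductSpace ComplexConjugate BigOperators
open Literature.MathematicalPhysics.QuantumFieldTheory.Balaban1983to89
open B11Eq103H1Complex B11Eq115Space B11Eq174Chart
open B11Eq111FrakG (nabla115 jetLinearEquiv)
open B13Contraction113 (QuadAnalytic)
open B9SectCLatticeCarrier (Bond bpos btgt shift unshift)
open B4Sect5Torus (TSite)
open B7Prop1Explicit (U1 Wcx boxVec)
open B7Prop2Explicit (pdev AvgClosed C0 c2')
open B7Prop3Flat (c3)
open B9Eq315QTorus (perCfg cornerSite)
open B9Eq315QTower (towerP UlevOf)
open B9Eq315QTowerFlat (perCfg_UlevOf_one_mem_U1 norm_Wcx_UlevOf_one_sub_one_le UlevOf_one)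
open B9Eq326OperatorTower (QkW laplaceAk RofUk)
open B9Eq310HessianOperator (adTransportW hessOp)
open B9Eq310DeltaPrime (plaqHolU plaqHolU_one)
open B9Eq324DeltaPrimeATower (laplacePrimeAk)
open B9Eq3119DeltaPiTower (laplaceAkPi)
open B9Eq3119DeltaPiTowerFlat (laplaceAkPi_one_pos_iff letters_laplaceAkPi_one)
open B11Eq118RegimeScalars (exists_twoRegimes_radii_of_bounds_room_cap)
open B11Eq44COperatorTower (C2T C2T_nonneg)
open B11Eq44CLetterTower (Cck quadAnalytic_Cck)
open B7Eq43AveragedSmallnessLevelFree (pdev_perCfg_le_of_plaq)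
open B11Eq117ChartLettersOnModel (exists_norm_chartLetters_le)
open B11Eq174ChartLipschitzAtFlatLatticeFreeClosed (exists_chartHB_lipschitz_at_flat_latticeFree)
open Summit.QuantumFields.BalabanUV.T4Continuum.NE9CurChartTowerPiLatticeUniformFlatWitness (flat_mem_class)
open Summit.QuantumFields.BalabanUV.T4Continuum.NE9CurChartTowerPiLipschitzAtFlatLatticeUniform (frakGLatticeCLM_laplaceAkPi_one H1LatticeCLM_laplaceAkPi_one)
open B11Eq44COperatorTowerTwoBackgrounds (sectC_modulus_tower)

variable {d : ℕ} (hd : 1 ≤ d) (L : ℕ) [NeZero L] (hL : 1 ≤ L) (hL2 : 2 ≤ L) (hL3 : 3 ≤ L) [Fact (0 < (L : ℝ))]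
  {𝔸 : Type*} [NormedRing 𝔸] [NormedAlgebra ℂ 𝔸] [CompleteSpace 𝔸] [NormOneClass 𝔸] [StarRing 𝔸] [NormedStarGroup 𝔸] [StarModule ℂ 𝔸] [FiniteDimensional ℂ 𝔸]
  {W : Type*} [NormedAddCommGroup W] [InnerProductSpace ℂ W] [FiniteDimensional ℂ W] (φ : W ≃ₗ[ℂ] 𝔸)
  {Mφ Mφ' : ℝ} (hMφ : 0 ≤ Mφ) (hMφ' : 0 ≤ Mφ') (hφ : ∀ w, ‖φ w‖ ≤ Mφ * ‖w‖) (hφ' : ∀ X, ‖φ.symm X‖ ≤ Mφ' * ‖X‖) (hstar : ∀ X : 𝔸, ‖star X‖ ≤ ‖X‖)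
  {a : ℝ} (ha : 0 < a) {a' : ℝ} (ha' : 0 < a') {ϱ : ℝ} (hϱ0 : 0 ≤ ϱ) (hϱ1 : ϱ < 1)
  (τ : 𝔸 →ₗ[ℂ] ℂ) {Cτ : ℝ} (hτ : ∀ X, ‖τ X‖ ≤ Cτ * ‖X‖) (hCτ : 0 ≤ Cτ) {Mτ : ℝ} (hτm : ∀ X Y : 𝔸, ‖τ (X * Y)‖ ≤ Mτ * ‖X‖ * ‖Y‖) (hMτ : 0 ≤ Mτ)
  {ρw : ℝ} (hρw : 0 ≤ ρw)
  (hτ₁ : ∀ X : 𝔸, τ (star X) = conj (τ X)) (hτ₂ : ∀ X Y : 𝔸, τ (X * Y) = τ (Y * X)) (hφτ : ∀ X Y : 𝔸, ⟪φ.symm X, φ.symm Y⟫_ℂ = τ (star X * Y))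
  (AQ : ℝ)
  {ι : Type} [Fintype ι] [DecidableEq ι] (b : Module.Basis ι ℝ 𝔸) {M₂ : ℝ} (hM₂ : 0 ≤ M₂) (hrepr : ∀ (v : 𝔸) (i : ι), |b.repr v i| ≤ M₂ * ‖v‖)
  {G : Subgroup 𝔸ˣ} (hG : AvgClosed d L G) {α₀ : ℝ} (hα₀ : 0 < α₀) (hα3 : C0 d * α₀ ≤ 1 / 3) (hα4 : 4 * α₀ ≤ c2' d L)
  {ρ : ℝ} (hρ0 : 0 < ρ) (hρ : Real.exp (4 * (800 * ((d : ℝ) + 1) ^ 2 * ((d : ℝ) + 4)) * α₀) * (1 + 8 * (131072 * ((d : ℝ) + 1) ^ 2) * ρ) ≤ 2)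
  (hρc : 2 * ρ ≤ c3 d L) {C₄ a₃ : ℝ} (hC₄ : 0 ≤ C₄) (ha₃ : 0 < a₃) {ω Ω : ℝ} (hω : 0 ≤ ω) (hΩ : 0 ≤ Ω)
  (hα8 : 8 * α₀ ≤ c2' d L) {r' r₇ : ℝ} (hr' : 0 < r') (hr₇ : 0 < r₇)
  (h7s' : Real.exp (4 * (800 * ((d : ℝ) + 1) ^ 2 * ((d : ℝ) + 4)) * α₀) * (1 + 8 * (131072 * ((d : ℝ) + 1) ^ 2) * r') ≤ 2)
  (h7c' : 2 * r' ≤ c3 d L) (h7r'1 : 409600 * ((d : ℝ) + 1) ^ 2 * r' ≤ 1)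
  (h7s : Real.exp (4480 * ((d : ℝ) + 1) ^ 2 * ((d : ℝ) + 4) * α₀ + 240000 * ((d : ℝ) + 1) ^ 3 * r') * (1 + 8 * (2097152 * ((d : ℝ) + 1) ^ 2) * r₇) ≤ 2)
  (h7c : 2 * r₇ ≤ c3 d L / 4)

/-! ## The face with `δ_C` discharged -/

-- deep definitional unfolding `laplaceAkPi` ↦ `laplaceALatticeK … (π†Δπ) …` in the statement (as the host)
set_option maxRecDepth 8192 in
set_option maxHeartbeats 9600000 in
include hd hL hL2 hL3 hMφ hMφ' hφ hφ' hstar ha ha' hϱ0 hϱ1 hτ hCτ hτm hMτ hρw hτ₁ hτ₂ hφτ hM₂ hrepr hG hα₀ hα3 hα4 hρ0 hρ hρc hC₄ ha₃ hω hΩ hα8 hr' hr₇ h7s' h7c' h7r'1 h7s h7c in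
/-- **THE CHART OF `cur U` AT PRINT's OPERATOR (3.122) IS LIPSCHITZ IN THE BACKGROUND AT THE FLAT POINT, LATTICE-UNIFORMLY** — see the module header:
`‖ι(chart_U B) − chart_1 B‖ ≤ K·((j₀ + α) + δ_W)` for every lattice of the tower, every background of the MODEL block, `B ∈ ball 0 R_b`, with
`α₁ j₁ ε₄ ε_C R_b r K` BEFORE `∀`; the (L3) slots' modulus `δ_W` displayed, `δ_C` DISCHARGED. [folklore]
[cite: Balaban1985Variational, Prop. 6 (116)–(121) p.295, (117) p.295, (174)–(175) p.305, (47) p.284, Prop. 9 p.309; Balaban1985BackgroundPropagators, Thm 3.4 p.400, (3.122) p.420, (3.126) p.420, (3.153) p.426, Thm 3.13 p.426] -/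
theorem cur_chart_tower_pi_lipschitz_at_flat_lattice_uniform_C :
    ∃ α₁ j₁ ε₄ εC Rb r K : ℝ, 0 < α₁ ∧ 0 < j₁ ∧ 0 < ε₄ ∧ 0 < εC ∧ 0 < Rb ∧ 0 < r ∧ 0 < K ∧
      ∀ (n : ℕ) (η : ℝ) [Fact (0 < η)] (_hηL : η * (L : ℝ) ^ (n + 1) = 1) (c₀ c₁ : ℝ) [Fact (0 < c₀)] [Fact (0 < c₁)]
        (_hw : c₀ * ((L : ℝ) ^ (n + 1)) ^ d = c₁) (_hρ : |η| ^ d / c₀ ≤ ρw) (m : Fin d → ℕ) [∀ i, NeZero (m i)] (_hm : ∀ i, 1 ≤ m i)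
        (U : Bond d (towerP L m (n + 1)) → 𝔸ˣ) (αU : ℕ → ℝ) (_hα0 : ∀ j, 0 ≤ αU j) (hα1 : ∀ j, αU j ≤ 1 / 64)
        (_hαL : ∀ j, 50 * (d + 1) * αU j * (L : ℝ) ^ d ≤ 1 / 2)
        (hU1 : ∀ (j : ℕ) (x : B7Prop1Explicit.Site d) (k : Fin d), perCfg (towerP L m (j + 1)) (UlevOf L m (n + 1) U j) x k ∈ U1 𝔸)
        (hreg : ∀ (j : ℕ) (y : TSite d (towerP L m j)) (k : Fin d) (ρ' : Fin d → Fin L),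
          ‖((Wcx L (perCfg (towerP L m (j + 1)) (UlevOf L m (n + 1) U j)) (cornerSite L y) k (boxVec L ρ') : 𝔸ˣ) : 𝔸) - 1‖ ≤ αU j)
        (εU : ℕ → ℝ) (_hεU : ∀ j, 0 ≤ εU j) (_hε1 : ∀ j, εU j ≤ 1) (_hUε : ∀ (j : ℕ) (b : Bond d (towerP L m (j + 1))), ‖(UlevOf L m (n + 1) U j b : 𝔸) - 1‖ ≤ εU j)
        (_hLb : ∀ (j : ℕ) (b : Bond d (towerP L m (j + 1))), UlevOf L m (n + 1) U j b ∈ U1 𝔸)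
        (α : ℝ) (_hα : 0 ≤ α) (_hαle : α ≤ α₁)
        (hUst : ∀ b, star (U b : 𝔸) = (((U b)⁻¹ : 𝔸ˣ) : 𝔸)) (_hUb : ∀ b, U b ∈ U1 𝔸) (_hUη : ∀ b, ‖(U b : 𝔸) - 1‖ ≤ α * η)
        (_hUw : ∀ (x : TSite d (towerP L m (n + 1))) (μ ν : Fin d), ‖(U (shift ν x, μ) : 𝔸) - (U (x, μ) : 𝔸)‖ ≤ α * η ^ 2)
        (_hpl : ∀ p : B9SectCLatticeCarrier.Plaq d (towerP L m (n + 1)), ‖(plaqHolU U p : 𝔸) - 1‖ ≤ α * η ^ 2)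
        (_hUgrad : ∀ (x : TSite d (towerP L m (n + 1))) (μ : Fin d), ‖(U (x, μ) : 𝔸) - U (unshift μ x, μ)‖ ≤ α * η ^ 2)
        (_hRlev : ∀ (j : ℕ) (b : Bond d (towerP L m (j + 1))) (w : W), ‖adTransportW φ (UlevOf L m (n + 1) U j) b w‖ ≤ ‖w‖)
        (_hεg : ∀ j < n + 1, εU j ≤ α * ϱ ^ j) (_hAQ : ∑ j ∈ Finset.range (n + 1), αU j ≤ AQ)
        (hpos' : ∀ x : SiteL2K ℂ d (towerP L m (n + 1)) c₀ W, x ≠ 0 → 0 < RCLike.re ⟪x, laplacePrimeAk L m n φ η U a' (c₁ := c₁) x⟫_ℂ)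
        (hpos : ∀ x : BondL2K ℂ d (towerP L m (n + 1)) c₀ W, x ≠ 0 →
          0 < RCLike.re ⟪x, laplaceAk L m n φ η U hL αU hα1 hU1 hreg τ (c₀ := c₀) (c₁ := c₁) a x⟫_ℂ)
        (_hc₀η : c₀ = η ^ d) (j₀ : ℝ) (_hJ : ∀ μ y, ‖B9Eq39Adjoint.J (fun μ => B9Eq33CovDerivVector.shiftEquiv μ) (fun μ y => U (y, μ)) η μ y‖ ≤ j₀) (_hj : j₀ ≤ j₁)
        (hposπ : ∀ x : BondL2K ℂ d (towerP L m (n + 1)) c₀ W, x ≠ 0 →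
          0 < RCLike.re ⟪x, laplaceAkPi L m n φ τ η U a' hpos' hL αU hα1 hU1 hreg (c₁ := c₁) a x⟫_ℂ)
        (hQ : Function.Surjective (QkW L m n φ U hL αU hα1 hU1 hreg (c₀ := c₀) (c₁ := c₁)))
        (hpos'₁ : ∀ x : SiteL2K ℂ d (towerP L m (n + 1)) c₀ W, x ≠ 0 →
          0 < RCLike.re ⟪x, laplacePrimeAk L m n φ η (fun _ : Bond d (towerP L m (n + 1)) => (1 : 𝔸ˣ)) a' (c₁ := c₁) x⟫_ℂ)
        (hpos₁ : ∀ x : BondL2K ℂ d (towerP L m (n + 1)) c₀ W, x ≠ 0 →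
          0 < RCLike.re ⟪x, laplaceAk L m n φ η (fun _ : Bond d (towerP L m (n + 1)) => (1 : 𝔸ˣ)) hL (fun _ => 0) (fun _ => by norm_num)
            (perCfg_UlevOf_one_mem_U1 L m (n + 1)) (norm_Wcx_UlevOf_one_sub_one_le L m (n + 1) (fun _ => 0) (fun _ => le_rfl)) τ
            (c₀ := c₀) (c₁ := c₁) a x⟫_ℂ)
        (hQ1 : Function.Surjective (QkW L m n φ (fun _ : Bond d (towerP L m (n + 1)) => (1 : 𝔸ˣ)) hL (fun _ => 0) (fun _ => by norm_num)
          (perCfg_UlevOf_one_mem_U1 L m (n + 1)) (norm_Wcx_UlevOf_one_sub_one_le L m (n + 1) (fun _ => 0) (fun _ => le_rfl)) (c₀ := c₀) (c₁ := c₁)))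
        (_hUG : ∀ (x : B7Prop1Explicit.Site d) (κ : Fin d), perCfg (towerP L m (n + 1)) U x κ ∈ G)
        (lev₀ : Bond d (towerP L m (n + 1)) → ℕ) (levB : Bond d m → ℕ) (lev₁ : Bond d (towerP L m (n + 1)) × Fin d → ℕ) (_hlev : ∀ b, n + 1 ≤ lev₀ b)
        (_hw₀ : (NegSup.wSup (levWeight (L : ℝ) η lev₀ 1) : ℝ) ≤ ω) (_hw₁ : (NegSup.wSup (levWeight (L : ℝ) η lev₁ 2) : ℝ) ≤ ω)
        (_hw₁' : (NegSup.wInvSup (levWeight (L : ℝ) η lev₀ 1) : ℝ) ≤ Ω)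
        (_hw₃ : (NegSup.wInvSup (levWeight (L : ℝ) η lev₀ 3) : ℝ) ≤ Ω) (_hwB : (NegSup.wInvSup (levWeight (L : ℝ) η levB 0) : ℝ) ≤ Ω)
        {W₁ : Space115 (L : ℝ) η lev₀ lev₁ (nabla115 η U) → NegSize (L : ℝ) η lev₀ 3 𝔸}
        {W₂ : Space115 (L : ℝ) η lev₀ lev₁ (nabla115 η (fun _ : Bond d (towerP L m (n + 1)) => (1 : 𝔸ˣ))) → NegSize (L : ℝ) η lev₀ 3 𝔸}
        (_hW₁ : QuadAnalytic W₁ C₄ a₃) (_hW₂ : QuadAnalytic W₂ C₄ a₃) {δW : ℝ} (_hδW0 : 0 ≤ δW)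
        (_hδW : ∀ P : Space115 (L : ℝ) η lev₀ lev₁ (nabla115 η U), ‖P‖ < r →
          ‖W₁ P - W₂ (LinearMap.toContinuousLinearMap
            ((jetLinearEquiv (L : ℝ) η lev₀ lev₁ (nabla115 η (fun _ : Bond d (towerP L m (n + 1)) => (1 : 𝔸ˣ)))).symm.toLinearMap ∘ₗ
              (jetLinearEquiv (L : ℝ) η lev₀ lev₁ (nabla115 η U)).toLinearMap) P)‖ ≤ δW)
        (B : NegSize (L : ℝ) η levB 0 𝔸) (_hBb : ‖B‖ < Rb),
        ‖LinearMap.toContinuousLinearMap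
              ((jetLinearEquiv (L : ℝ) η lev₀ lev₁ (nabla115 η (fun _ : Bond d (towerP L m (n + 1)) => (1 : 𝔸ˣ)))).symm.toLinearMap ∘ₗ
                (jetLinearEquiv (L : ℝ) η lev₀ lev₁ (nabla115 η U)).toLinearMap)
            (chartHB (frakGLatticeCLM (L := (L : ℝ)) (η := η) (lev₀ := lev₀) φ hposπ hQ lev₁ (nabla115 η U)) 0 W₁ 0
              (fun A' => A' + solA (H1LatticeCLM (L := (L : ℝ)) (η := η) (lev₀ := lev₀) (levB := levB) φ hposπ hQ lev₁ (nabla115 η U)) 0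
                (Cck L m η (n + 1) U lev₀ lev₁ (nabla115 η U) levB) 0 εC A') ε₄
              (H1LatticeCLM (L := (L : ℝ)) (η := η) (lev₀ := lev₀) (levB := levB) φ hposπ hQ lev₁ (nabla115 η U)) B) -
          chartHB (frakGLatticeCLM (L := (L : ℝ)) (η := η) (lev₀ := lev₀) (c := ((η : ℂ))⁻¹)
              (R := adTransportW φ (fun _ : Bond d (towerP L m (n + 1)) => (1 : 𝔸ˣ)))
              (S := adTransportW φ fun _ : Bond d (towerP L m (n + 1)) => (1 : 𝔸ˣ)⁻¹) (Δ₁ := hessOp φ η (fun _ : Bond d (towerP L m (n + 1)) => (1 : 𝔸ˣ)) τ)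
              (Rr := RofUk L m n φ η (fun _ : Bond d (towerP L m (n + 1)) => (1 : 𝔸ˣ)))
              (Q := (QkW L m n φ (fun _ : Bond d (towerP L m (n + 1)) => (1 : 𝔸ˣ)) hL (fun _ => 0) (fun _ => by norm_num)
                (perCfg_UlevOf_one_mem_U1 L m (n + 1)) (norm_Wcx_UlevOf_one_sub_one_le L m (n + 1) (fun _ => 0) (fun _ => le_rfl)) (c₀ := c₀) (c₁ := c₁))) (a := a)
              φ hpos₁ hQ1 lev₁ (nabla115 η (fun _ : Bond d (towerP L m (n + 1)) => (1 : 𝔸ˣ)))) 0 W₂ 0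
            (fun A' => A' + solA (H1LatticeCLM (L := (L : ℝ)) (η := η) (lev₀ := lev₀) (levB := levB) (c := ((η : ℂ))⁻¹)
              (R := adTransportW φ (fun _ : Bond d (towerP L m (n + 1)) => (1 : 𝔸ˣ)))
              (S := adTransportW φ fun _ : Bond d (towerP L m (n + 1)) => (1 : 𝔸ˣ)⁻¹) (Δ₁ := hessOp φ η (fun _ : Bond d (towerP L m (n + 1)) => (1 : 𝔸ˣ)) τ)
              (Rr := RofUk L m n φ η (fun _ : Bond d (towerP L m (n + 1)) => (1 : 𝔸ˣ)))
              (Q := (QkW L m n φ (fun _ : Bond d (towerP L m (n + 1)) => (1 : 𝔸ˣ)) hL (fun _ => 0) (fun _ => by norm_num)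
                (perCfg_UlevOf_one_mem_U1 L m (n + 1)) (norm_Wcx_UlevOf_one_sub_one_le L m (n + 1) (fun _ => 0) (fun _ => le_rfl)) (c₀ := c₀) (c₁ := c₁))) (a := a)
              φ hpos₁ hQ1 lev₁ (nabla115 η (fun _ : Bond d (towerP L m (n + 1)) => (1 : 𝔸ˣ)))) 0
              (Cck L m η (n + 1) (fun _ : Bond d (towerP L m (n + 1)) => (1 : 𝔸ˣ)) lev₀ lev₁ (nabla115 η (fun _ : Bond d (towerP L m (n + 1)) => (1 : 𝔸ˣ))) levB) 0 εC A') ε₄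
            (H1LatticeCLM (L := (L : ℝ)) (η := η) (lev₀ := lev₀) (levB := levB) (c := ((η : ℂ))⁻¹)
              (R := adTransportW φ (fun _ : Bond d (towerP L m (n + 1)) => (1 : 𝔸ˣ)))
              (S := adTransportW φ fun _ : Bond d (towerP L m (n + 1)) => (1 : 𝔸ˣ)⁻¹) (Δ₁ := hessOp φ η (fun _ : Bond d (towerP L m (n + 1)) => (1 : 𝔸ˣ)) τ)
              (Rr := RofUk L m n φ η (fun _ : Bond d (towerP L m (n + 1)) => (1 : 𝔸ˣ)))
              (Q := (QkW L m n φ (fun _ : Bond d (towerP L m (n + 1)) => (1 : 𝔸ˣ)) hL (fun _ => 0) (fun _ => by norm_num)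
                (perCfg_UlevOf_one_mem_U1 L m (n + 1)) (norm_Wcx_UlevOf_one_sub_one_le L m (n + 1) (fun _ => 0) (fun _ => le_rfl)) (c₀ := c₀) (c₁ := c₁))) (a := a)
              φ hpos₁ hQ1 lev₁ (nabla115 η (fun _ : Bond d (towerP L m (n + 1)) => (1 : 𝔸ˣ)))) B‖ ≤
          K * ((j₀ + α) + δW) := by
  classical
  -- (0) the suppliers, `∃`-first: the chart-level Lipschitz letters (ROUTE (J′)), the two operator norms, the scalar letters WITH ROOM
  obtain ⟨αL, jL, KA, KG, KD, hαL0, hjL, hKA, hKG, hKD, HLip⟩ :=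
    exists_chartHB_lipschitz_at_flat_latticeFree hd L hL hL3 φ hMφ hMφ' hφ hφ' hstar ha ha' hϱ0 hϱ1 τ hτ hCτ hτm hMτ hρw hτ₁ hτ₂ hφτ AQ b hM₂ hrepr
  obtain ⟨αN, jN, BN, hαN, hjN, hBN, HN⟩ :=
    exists_norm_chartLetters_le hd L hL hL3 φ hMφ hMφ' hφ hφ' hstar ha ha' hϱ0 hϱ1 τ hτ hCτ hτm hMτ hρw hτ₁ hτ₂ hφτ AQ
  obtain ⟨CG, hCGd⟩ : ∃ C : ℝ, C = ω * (Mφ * BN * Mφ') * Ω := ⟨_, rfl⟩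
  have hCG : 0 ≤ CG := by rw [hCGd]; positivity
  obtain ⟨jr, ar, ε₄, aC, εC, Rb, hjr, har, hε₄, haC, hεC, hRb, hcap, hcapC, ⟨hdom6, hcontr12, hCdom6, hCcontr12⟩, Hreg⟩ :=
    exists_twoRegimes_radii_of_bounds_room_cap (B₀ := CG) (b := CG) (b₁ := CG) (C₄ := C₄) (a₃ := a₃) (C₂ := C2T d α₀) (c₄ := ρ) (δ := r₇ / 2)
      hCG hCG hCG hC₄ ha₃ (C2T_nonneg d α₀) hρ0 (half_pos hr₇)
  -- the two denominators and the constant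
  obtain ⟨D₁, hD₁⟩ : ∃ D : ℝ, D = 1 - (0 + 4 * CG * C₄ * (2 * (ε₄ + ar) + (ε₄ + ar))) := ⟨_, rfl⟩
  obtain ⟨D₂, hD₂⟩ : ∃ D : ℝ, D = 1 - 4 * CG * C2T d α₀ * (2 * (εC + aC) + (εC + aC)) := ⟨_, rfl⟩
  have hD₁0 : 0 < D₁ := by rw [hD₁]; linarith [hcontr12]
  have hD₂0 : 0 < D₂ := by rw [hD₂]; linarith [hCcontr12]
  obtain ⟨Pw, hPw⟩ : ∃ P : ℝ, P = ω * (Mφ * Mφ') * Ω := ⟨_, rfl⟩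
  have hPw0 : 0 ≤ Pw := by rw [hPw]; positivity
  obtain ⟨⟨X1, hX1⟩, ⟨X4, hX4⟩, ⟨X5, hX5⟩⟩ : (∃ X : ℝ, X = Pw * (KG + KD) * (jr + C₄ * (ε₄ + ar) ^ 2)) ∧ (∃ X : ℝ, X = Pw * KA * Rb) ∧
      (∃ X : ℝ, X = Pw * KA * (C2T d α₀ * (εC + aC) ^ 2)) := ⟨⟨_, rfl⟩, ⟨_, rfl⟩, ⟨_, rfl⟩⟩
  have hC2T := C2T_nonneg d α₀
  obtain ⟨hX10, hX40, hX50⟩ : 0 ≤ X1 ∧ 0 ≤ X4 ∧ 0 ≤ X5 := ⟨by rw [hX1]; positivity, by rw [hX4]; positivity, by rw [hX5]; positivity⟩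
  obtain ⟨c1, hc1⟩ : ∃ c : ℝ, c = 1 / D₂ * ((X1 + X4) / D₁) + X5 / D₂ := ⟨_, rfl⟩
  obtain ⟨⟨c2, hc2⟩, ⟨c3, hc3⟩⟩ : (∃ c : ℝ, c = 1 / D₂ * (CG / D₁)) ∧ (∃ c : ℝ, c = CG / D₂) := ⟨⟨_, rfl⟩, ⟨_, rfl⟩⟩
  obtain ⟨hc10, hc20, hc30⟩ : 0 ≤ c1 ∧ 0 ≤ c2 ∧ 0 ≤ c3 := ⟨by rw [hc1]; positivity, by rw [hc2]; positivity, by rw [hc3]; positivity⟩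
  obtain ⟨cC, hcC⟩ : ∃ c : ℝ, c = 24 / r' * (εC + aC) := ⟨_, rfl⟩
  have hcC0 : 0 ≤ cC := by rw [hcC]; positivity
  obtain ⟨K, hK⟩ : ∃ K : ℝ, K = c1 + c3 * cC + c2 + 1 := ⟨_, rfl⟩
  refine ⟨min (min (min αL αN) (min (α₀ / 2) (1 / (2 * ω * Ω + 1)))) (r' / 6), min jL jN, ε₄, εC, Rb, εC + aC, K,
    lt_min (lt_min (lt_min hαL0 hαN) (lt_min (by positivity) (by positivity))) (by positivity), lt_min hjL hjN, hε₄, hεC, hRb, by linarith, by rw [hK]; positivity, ?_⟩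
  intro n η _ hηL c₀ c₁ _ _ hw hρ' m _ hm U αU hα0 hα1 hαL hU1 hreg εU hεU hε1 hUε hLb α hα hαle' hUst hUb hUη hUw hpl hUgrad hRlev hεg hAQ hpos' hpos hc₀η j₀ hJ hj
    hposπ hQ hpos'₁ hpos₁ hQ1 hUG lev₀ levB lev₁ hlev hw₀ hw₁ hw₁' hw₃ hwB W₁ W₂ hW₁ hW₂ δW hδW0 hδW B hBb
  obtain ⟨hαle, hαr'⟩ : α ≤ min (min αL αN) (min (α₀ / 2) (1 / (2 * ω * Ω + 1))) ∧ α ≤ r' / 6 := ⟨hαle'.trans (min_le_left _ _), hαle'.trans (min_le_right _ _)⟩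
  obtain ⟨hαL', hαN', hαh, hαw⟩ : α ≤ αL ∧ α ≤ αN ∧ α ≤ α₀ / 2 ∧ α ≤ 1 / (2 * ω * Ω + 1) :=
    ⟨hαle.trans ((min_le_left _ _).trans (min_le_left _ _)), hαle.trans ((min_le_left _ _).trans (min_le_right _ _)),
      hαle.trans ((min_le_right _ _).trans (min_le_left _ _)), hαle.trans ((min_le_right _ _).trans (min_le_right _ _))⟩
  -- `δ_C` PRODUCED: [B7] Prop. 7 at `k = n+1` levels read as a background modulus (`sectC_modulus_tower`) at `ρ′ := r′∕L^{n+1}`, `ρ := r∕L^{n+1}`, `ε := αη`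
  have hK1 : (1 : ℝ) ≤ (L : ℝ) ^ (n + 1) := one_le_pow₀ (by exact_mod_cast hL)
  have hK0' : (0 : ℝ) < (L : ℝ) ^ (n + 1) := lt_of_lt_of_le one_pos hK1
  have hkr' : (L : ℝ) ^ (n + 1) * (r' / (L : ℝ) ^ (n + 1)) = r' := mul_div_cancel₀ _ hK0'.ne'
  have hkr : (L : ℝ) ^ (n + 1) * (r₇ / (L : ℝ) ^ (n + 1)) = r₇ := mul_div_cancel₀ _ hK0'.ne'
  have hkε : (L : ℝ) ^ (n + 1) * (α * η) = α := by rw [mul_comm, mul_assoc, hηL, mul_one]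
  have hη0' : 0 < η := Fact.out
  have hδC := sectC_modulus_tower L m η (n + 1) U hL2 hG hα₀ hα3 hα8 (ρ' := r' / (L : ℝ) ^ (n + 1)) (ρ := r₇ / (L : ℝ) ^ (n + 1)) (by positivity) (by positivity)
    (by rw [hkr']; exact h7s') (by rw [hkr']; exact h7c') (by rw [hkr']; exact h7r'1) (by rw [hkr', hkr]; exact h7s) (by rw [hkr]; exact h7c)
    (ε := α * η) (by positivity) hUη (by rw [le_div_iff₀ hK0']; nlinarith [hαr', hkε]) lev₀ levB hlev lev₁ (εC := εC) (aC := aC) (by rw [hkr]; linarith [hcapC])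
  rw [hkr', hkε] at hδC
  have hδC0 : 0 ≤ 24 / r' * α * (εC + aC) := by positivity
  obtain ⟨hjL', hjN'⟩ : j₀ ≤ jL ∧ j₀ ≤ jN := ⟨hj.trans (min_le_left _ _), hj.trans (min_le_right _ _)⟩
  have hx : 0 ≤ j₀ + α := add_nonneg ((norm_nonneg _).trans (hJ ⟨0, hd⟩ fun _ => 0)) hα
  have hη0 : 0 < η := Fact.out
  -- (1) per lattice: (52) at `U` and at the vacuum from the plaquette window; `C_k`'s letters
  have hηinv : ((L : ℝ) ^ (n + 1))⁻¹ = η := inv_eq_of_mul_eq_one_left hηL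
  have h52 : pdev (perCfg (towerP L m (n + 1)) U) < α₀ * (((L : ℝ) ^ (n + 1))⁻¹) ^ 2 := by
    have hp := pdev_perCfg_le_of_plaq (U := U) hUb (by positivity) hpl
    rw [hηinv]
    exact lt_of_le_of_lt hp (mul_lt_mul_of_pos_right (by linarith) (by positivity))
  obtain ⟨-, hUη1, hpl1, hUgrad1, hJ1⟩ := flat_mem_class L m n η (𝔸 := 𝔸)
  have hUb1 : ∀ b' : Bond d (towerP L m (n + 1)), (fun _ : Bond d (towerP L m (n + 1)) => (1 : 𝔸ˣ)) b' ∈ U1 𝔸 := fun _ => one_mem _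
  have hUG1 : ∀ (x : B7Prop1Explicit.Site d) (κ : Fin d), perCfg (towerP L m (n + 1)) (fun _ : Bond d (towerP L m (n + 1)) => (1 : 𝔸ˣ)) x κ ∈ G :=
    fun x κ => by rw [B9Eq315QTorus.perCfg_apply]; exact G.one_mem
  have h52₁ : pdev (perCfg (towerP L m (n + 1)) (fun _ : Bond d (towerP L m (n + 1)) => (1 : 𝔸ˣ))) < α₀ * (((L : ℝ) ^ (n + 1))⁻¹) ^ 2 := by
    have hp := pdev_perCfg_le_of_plaq (U := fun _ : Bond d (towerP L m (n + 1)) => (1 : 𝔸ˣ)) hUb1 (by positivity : (0 : ℝ) ≤ 0 * η ^ 2) hpl1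
    rw [hηinv]
    exact lt_of_le_of_lt hp (mul_lt_mul_of_pos_right (by linarith) (by positivity))
  have hCk := quadAnalytic_Cck L m η (n + 1) U lev₀ lev₁ (nabla115 η U) levB hL2 hG hUG hα₀ hα3 hα4 h52 hlev hρ hρc
  have hCk1 := quadAnalytic_Cck L m η (n + 1) (fun _ : Bond d (towerP L m (n + 1)) => (1 : 𝔸ˣ)) lev₀ lev₁
    (nabla115 η (fun _ : Bond d (towerP L m (n + 1)) => (1 : 𝔸ˣ))) levB hL2 hG hUG1 hα₀ hα3 hα4 h52₁ hlev hρ hρc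
  -- the flat class data
  have hαL1 : ∀ j : ℕ, 50 * (d + 1) * (fun _ : ℕ => (0 : ℝ)) j * (L : ℝ) ^ d ≤ 1 / 2 := fun _ => by norm_num
  have hUε1 : ∀ (j : ℕ) (b' : Bond d (towerP L m (j + 1))), ‖(UlevOf L m (n + 1) (fun _ : Bond d (towerP L m (n + 1)) => (1 : 𝔸ˣ)) j b' : 𝔸) - 1‖ ≤ (fun _ : ℕ => (0 : ℝ)) j :=
    fun j b' => by rw [UlevOf_one]; simp
  have hLb1 : ∀ (j : ℕ) (b' : Bond d (towerP L m (j + 1))), UlevOf L m (n + 1) (fun _ : Bond d (towerP L m (n + 1)) => (1 : 𝔸ˣ)) j b' ∈ U1 𝔸 := fun j b' => by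
    rw [UlevOf_one]; exact one_mem _
  have hRlev1 : ∀ (j : ℕ) (b' : Bond d (towerP L m (j + 1))) (w : W), ‖adTransportW φ (UlevOf L m (n + 1) (fun _ : Bond d (towerP L m (n + 1)) => (1 : 𝔸ˣ)) j) b' w‖ ≤ ‖w‖ :=
    fun j b' w => by rw [UlevOf_one, B5Eq172HodgePositivity.adTransportW_one, LinearMap.id_apply]
  have hUst1 : ∀ b' : Bond d (towerP L m (n + 1)), star ((fun _ : Bond d (towerP L m (n + 1)) => (1 : 𝔸ˣ)) b' : 𝔸) =
      ((((fun _ : Bond d (towerP L m (n + 1)) => (1 : 𝔸ˣ)) b')⁻¹ : 𝔸ˣ) : 𝔸) := fun _ => by simp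
  have hεg1 : ∀ j < n + 1, (fun _ : ℕ => (0 : ℝ)) j ≤ 0 * ϱ ^ j := fun _ _ => by simp
  have hAQ1 : ∑ j ∈ Finset.range (n + 1), (fun _ : ℕ => (0 : ℝ)) j ≤ AQ := by simpa using (Finset.sum_nonneg fun j _ => hα0 j).trans hAQ
  have hposπ₁ := (laplaceAkPi_one_pos_iff L m n φ τ η a' hpos'₁ hL (fun _ => 0) (fun _ => by norm_num)
    (perCfg_UlevOf_one_mem_U1 L m (n + 1)) (norm_Wcx_UlevOf_one_sub_one_le L m (n + 1) (fun _ => 0) (fun _ => le_rfl)) a (c₀ := c₀)).mpr hpos₁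
  -- (2) the two operator norms at `U` and at the vacuum, against the ONE majorant `CG`
  obtain ⟨hGb, hHb⟩ := HN n η hηL c₀ c₁ hw hρ' m hm U αU hα0 hα1 hαL hU1 hreg εU hεU hUε hLb α hα hαN' hUst hUb hUη hpl hUgrad hRlev hεg hAQ hpos' hpos hc₀η
    j₀ hJ hjN' hposπ hQ (L : ℝ) η lev₀ lev₁ levB
  obtain ⟨hGb1, hHb1⟩ := HN n η hηL c₀ c₁ hw hρ' m hm (fun _ : Bond d (towerP L m (n + 1)) => (1 : 𝔸ˣ)) (fun _ => 0) (fun _ => le_rfl) (fun _ => by norm_num) hαL1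
    (perCfg_UlevOf_one_mem_U1 L m (n + 1)) (norm_Wcx_UlevOf_one_sub_one_le L m (n + 1) (fun _ => 0) (fun _ => le_rfl)) (fun _ => 0) (fun _ => le_rfl) hUε1 hLb1
    0 le_rfl hαN.le hUst1 hUb1 hUη1 hpl1 hUgrad1 hRlev1 hεg1 hAQ1 hpos'₁ hpos₁ hc₀η 0 hJ1 hjN.le hposπ₁ hQ1 (L : ℝ) η lev₀ lev₁ levB
  rw [frakGLatticeCLM_laplaceAkPi_one L hL φ τ m n η hpos'₁ hpos₁ hposπ₁ hQ1 lev₀ lev₁] at hGb1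
  rw [H1LatticeCLM_laplaceAkPi_one L hL φ τ m n η hpos'₁ hpos₁ hposπ₁ hQ1 lev₀ levB lev₁] at hHb1
  have hMB : 0 ≤ Mφ * BN * Mφ' := by positivity
  have hmax : max ((NegSup.wSup (levWeight (L : ℝ) η lev₀ 1) : ℝ) * (Mφ * BN * Mφ')) (NegSup.wSup (levWeight (L : ℝ) η lev₁ 2) * (Mφ * BN * Mφ')) ≤
      ω * (Mφ * BN * Mφ') :=
    max_le (mul_le_mul_of_nonneg_right hw₀ hMB) (mul_le_mul_of_nonneg_right hw₁ hMB)
  obtain ⟨hw3n, hwBn⟩ := And.intro (NegSup.wInvSup (levWeight (L : ℝ) η lev₀ 3)).coe_nonneg (NegSup.wInvSup (levWeight (L : ℝ) η levB 0)).coe_nonneg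
  have hωB : 0 ≤ ω * (Mφ * BN * Mφ') := by positivity
  have hGb' := hGb.trans ((mul_le_mul hmax hw₃ hw3n hωB).trans (le_of_eq hCGd.symm))
  have hHb' := hHb.trans ((mul_le_mul hmax hwB hwBn hωB).trans (le_of_eq hCGd.symm))
  have hGb1' := hGb1.trans ((mul_le_mul hmax hw₃ hw3n hωB).trans (le_of_eq hCGd.symm))
  have hHb1' := hHb1.trans ((mul_le_mul hmax hwB hwBn hωB).trans (le_of_eq hCGd.symm))
  -- (3) the four regimes and the datum letter, from the scalar letters with room
  obtain ⟨R₁, RC₁, hB₁⟩ := Hreg _ W₁ _ _ _ (fun f => (ContinuousLinearMap.le_opNorm _ f).trans (mul_le_mul_of_nonneg_right hGb' (norm_nonneg f))) hW₁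
    (fun Y => (ContinuousLinearMap.le_opNorm _ Y).trans (mul_le_mul_of_nonneg_right hHb' (norm_nonneg Y))) hCk
    (fun Y => (ContinuousLinearMap.le_opNorm _ Y).trans (mul_le_mul_of_nonneg_right hHb' (norm_nonneg Y)))
  obtain ⟨R₂, RC₂, hB₂⟩ := Hreg _ W₂ _ _ _ (fun f => (ContinuousLinearMap.le_opNorm _ f).trans (mul_le_mul_of_nonneg_right hGb1' (norm_nonneg f))) hW₂
    (fun Y => (ContinuousLinearMap.le_opNorm _ Y).trans (mul_le_mul_of_nonneg_right hHb1' (norm_nonneg Y))) hCk1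
    (fun Y => (ContinuousLinearMap.le_opNorm _ Y).trans (mul_le_mul_of_nonneg_right hHb1' (norm_nonneg Y)))
  obtain ⟨hBU, hB1⟩ := And.intro (hB₁ B (mem_ball_zero_iff.mpr hBb)) (hB₂ B (mem_ball_zero_iff.mpr hBb))
  -- the jet identity's letter `K_ι = 1 + w̄₁·2α·w̲₁⁻¹ ≤ 2`
  have hKι : 1 + (NegSup.wSup (levWeight (L : ℝ) η lev₁ 2) : ℝ) * (2 * α) * NegSup.wInvSup (levWeight (L : ℝ) η lev₀ 1) ≤ 2 := by
    have h1 : (NegSup.wSup (levWeight (L : ℝ) η lev₁ 2) : ℝ) * (2 * α) * NegSup.wInvSup (levWeight (L : ℝ) η lev₀ 1) ≤ ω * (2 * α) * Ω :=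
      mul_le_mul (mul_le_mul_of_nonneg_right hw₁ (by positivity)) hw₁' (NegSup.wInvSup (levWeight (L : ℝ) η lev₀ 1)).coe_nonneg (by positivity)
    have h2 : α * (2 * ω * Ω + 1) ≤ 1 := by rw [← le_div_iff₀ (by positivity)]; exact hαw
    nlinarith [mul_nonneg hω hΩ, mul_nonneg (mul_nonneg hω hΩ) hα, h1, h2]
  obtain ⟨hs0, hsC0⟩ : 0 < ε₄ + ar ∧ 0 < εC + aC := ⟨by linarith, by linarith⟩
  -- (4) THE CHART-LEVEL COMPOSITION with every scalar letter produced
  have hmain := HLip n η hηL c₀ c₁ hw hρ' m hm U αU hα0 hα1 hαL hU1 hreg εU hεU hε1 hUε hLb α hα hαL' hUst hUb hUη hUw hpl hUgrad hRlev hεg hAQ hpos' hpos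
    hc₀η j₀ hJ hjL' hposπ hQ hpos'₁ hpos₁ hQ1 lev₀ levB lev₁ R₁ R₂ hjr.le hjr.le B hBU hB1
    (fun P hP => hδW P (hP.trans_le (hcap.trans (by linarith))))
    (show (1 + (NegSup.wSup (levWeight (L : ℝ) η lev₁ 2) : ℝ) * (2 * α) * NegSup.wInvSup (levWeight (L : ℝ) η lev₀ 1)) * (ε₄ + ar) ≤ 2 * (ε₄ + ar) from
      mul_le_mul_of_nonneg_right hKι hs0.le)
    (show ε₄ + ar ≤ 2 * (ε₄ + ar) by linarith) (show 0 < ε₄ + ar from hs0) (show 2 * (2 * (ε₄ + ar) + (ε₄ + ar)) ≤ a₃ by linarith)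
    (show 0 + 4 * CG * C₄ * (2 * (ε₄ + ar) + (ε₄ + ar)) < 1 by linarith) RC₁ RC₂ hcap hcap hδC
    (show (1 + (NegSup.wSup (levWeight (L : ℝ) η lev₁ 2) : ℝ) * (2 * α) * NegSup.wInvSup (levWeight (L : ℝ) η lev₀ 1)) * (εC + aC) ≤ 2 * (εC + aC) from
      mul_le_mul_of_nonneg_right hKι hsC0.le)
    (show εC + aC ≤ 2 * (εC + aC) by linarith) (show 0 < εC + aC from hsC0) (show 2 * (2 * (εC + aC) + (εC + aC)) ≤ ρ by linarith)
    (show 4 * CG * C2T d α₀ * (2 * (εC + aC) + (εC + aC)) < 1 by linarith)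
  rw [← hD₁, ← hD₂] at hmain
  refine hmain.trans ?_
  -- (5) the constants
  obtain ⟨hw0n, hw1n⟩ := And.intro (NegSup.wSup (levWeight (L : ℝ) η lev₀ 1)).coe_nonneg (NegSup.wSup (levWeight (L : ℝ) η lev₁ 2)).coe_nonneg
  have hMle : ∀ {X Y : ℝ}, 0 ≤ X → X ≤ Y → ∀ {v : ℝ}, 0 ≤ v → v ≤ Ω →
      max ((NegSup.wSup (levWeight (L : ℝ) η lev₀ 1) : ℝ) * (Mφ * ((j₀ + α) * X) * Mφ')) (NegSup.wSup (levWeight (L : ℝ) η lev₁ 2) * (Mφ * ((j₀ + α) * X) * Mφ')) * v ≤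
        (j₀ + α) * (Pw * Y) := by
    intro X Y hX0 hXY v hv0 hvΩ
    have h1 : Mφ * ((j₀ + α) * X) * Mφ' ≤ Mφ * ((j₀ + α) * Y) * Mφ' := mul_le_mul_of_nonneg_right (mul_le_mul_of_nonneg_left (mul_le_mul_of_nonneg_left hXY hx) hMφ) hMφ'
    have h0 : 0 ≤ Mφ * ((j₀ + α) * Y) * Mφ' := by have := hX0.trans hXY; positivity
    have hM : max ((NegSup.wSup (levWeight (L : ℝ) η lev₀ 1) : ℝ) * (Mφ * ((j₀ + α) * X) * Mφ')) (NegSup.wSup (levWeight (L : ℝ) η lev₁ 2) * (Mφ * ((j₀ + α) * X) * Mφ')) ≤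
        ω * (Mφ * ((j₀ + α) * Y) * Mφ') :=
      max_le ((mul_le_mul_of_nonneg_left h1 hw0n).trans (mul_le_mul_of_nonneg_right hw₀ h0)) ((mul_le_mul_of_nonneg_left h1 hw1n).trans (mul_le_mul_of_nonneg_right hw₁ h0))
    calc _ ≤ ω * (Mφ * ((j₀ + α) * Y) * Mφ') * Ω := mul_le_mul hM hvΩ hv0 (mul_nonneg hω h0)
      _ = (j₀ + α) * (Pw * Y) := by rw [hPw]; ring
  have ht1 := hMle hKG (show KG ≤ KG + KD by linarith) hw3n hw₃
  have ht1' := hMle hKD (show KD ≤ KG + KD by linarith) hw3n hw₃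
  have ht2 := hMle hKA le_rfl hwBn hwB
  have hmaxGD : max ((NegSup.wSup (levWeight (L : ℝ) η lev₀ 1) : ℝ) * (Mφ * ((j₀ + α) * KG) * Mφ')) (NegSup.wSup (levWeight (L : ℝ) η lev₁ 2) * (Mφ * ((j₀ + α) * KD) * Mφ')) *
      NegSup.wInvSup (levWeight (L : ℝ) η lev₀ 3) ≤ (j₀ + α) * (Pw * (KG + KD)) := by
    rcases le_total ((NegSup.wSup (levWeight (L : ℝ) η lev₀ 1) : ℝ) * (Mφ * ((j₀ + α) * KG) * Mφ')) (NegSup.wSup (levWeight (L : ℝ) η lev₁ 2) * (Mφ * ((j₀ + α) * KD) * Mφ')) with h | h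
    · rw [max_eq_right h]; exact (mul_le_mul_of_nonneg_right (le_max_right _ _) hw3n).trans ht1'
    · rw [max_eq_left h]; exact (mul_le_mul_of_nonneg_right (le_max_left _ _) hw3n).trans ht1
  have hnum1 : max ((NegSup.wSup (levWeight (L : ℝ) η lev₀ 1) : ℝ) * (Mφ * ((j₀ + α) * KG) * Mφ')) (NegSup.wSup (levWeight (L : ℝ) η lev₁ 2) * (Mφ * ((j₀ + α) * KD) * Mφ')) *
        NegSup.wInvSup (levWeight (L : ℝ) η lev₀ 3) * (jr + C₄ * (ε₄ + ar) ^ 2) + 0 * (ε₄ + ar) + CG * δW +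
      max ((NegSup.wSup (levWeight (L : ℝ) η lev₀ 1) : ℝ) * (Mφ * ((j₀ + α) * KA) * Mφ')) (NegSup.wSup (levWeight (L : ℝ) η lev₁ 2) * (Mφ * ((j₀ + α) * KA) * Mφ')) *
        NegSup.wInvSup (levWeight (L : ℝ) η levB 0) * ‖B‖ ≤ (j₀ + α) * (X1 + X4) + CG * δW := by
    have h1 := mul_le_mul_of_nonneg_right hmaxGD (show 0 ≤ jr + C₄ * (ε₄ + ar) ^ 2 by positivity)
    have h2 := mul_le_mul ht2 hBb.le (norm_nonneg B) (by positivity)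
    rw [hX1, hX4]; linarith [h1, h2]
  have hnum2 : max ((NegSup.wSup (levWeight (L : ℝ) η lev₀ 1) : ℝ) * (Mφ * ((j₀ + α) * KA) * Mφ')) (NegSup.wSup (levWeight (L : ℝ) η lev₁ 2) * (Mφ * ((j₀ + α) * KA) * Mφ')) *
        NegSup.wInvSup (levWeight (L : ℝ) η levB 0) * (C2T d α₀ * (εC + aC) ^ 2) + CG * (24 / r' * α * (εC + aC)) ≤
      (j₀ + α) * X5 + CG * (24 / r' * α * (εC + aC)) := by
    have h1 := mul_le_mul_of_nonneg_right ht2 (show 0 ≤ C2T d α₀ * (εC + aC) ^ 2 by positivity)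
    rw [hX5]; linarith [h1]
  have hiD₂ : 0 ≤ 1 / D₂ := div_nonneg zero_le_one hD₂0.le
  refine (add_le_add (mul_le_mul_of_nonneg_left (div_le_div_of_nonneg_right hnum1 hD₁0.le) hiD₂) (div_le_div_of_nonneg_right hnum2 hD₂0.le)).trans ?_
  have e : 1 / D₂ * (((j₀ + α) * (X1 + X4) + CG * δW) / D₁) + ((j₀ + α) * X5 + CG * (24 / r' * α * (εC + aC))) / D₂ =
      (j₀ + α) * c1 + δW * c2 + α * (c3 * cC) := by
    rw [hc1, hc2, hc3, hcC]; field_simp; ring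
  rw [e, hK]
  have hj₀0 : 0 ≤ j₀ := (norm_nonneg _).trans (hJ ⟨0, hd⟩ fun _ => 0)
  linarith [mul_nonneg hx (show 0 ≤ c2 + 1 by positivity), mul_nonneg hδW0 (show 0 ≤ c1 + c3 * cC + 1 by positivity), mul_nonneg hj₀0 (mul_nonneg hc30 hcC0),
    mul_nonneg hx (mul_nonneg hc30 hcC0)]

end Summit.QuantumFields.BalabanUV.T4Continuum.NE9CurChartTowerPiLipschitzAtFlatLatticeUniformC

end
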